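import Summits.AtomisticToContinuum.Crystallization.Theorems.FrustratedLawDichotomyStrainedPatchHomLeafTableSumsHcpV
import Summits.AtomisticToContinuum.Crystallization.Theorems.FrustratedLawDichotomyStrainedPatchHomLeafMomentsHcpV
import Summits.AtomisticToContinuum.Crystallization.Theorems.FrustratedLawDichotomyStrainedPatchHomLeafTableSoundHcp

/-!
# hcp vector-form leaf checker — REAL READINGS of the per-label integers (centre value, deviation bound, radius)

decomp-a2c hand-2 g25 (crux `AperiodicFrustratedLawGap`, stmt-AtomisticToContinuum-27623; (H) hcp P-twin, critic rows 887/891/893).  The bridge,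
part 1: `Fin 3`-indexed readings of the leaf data `LV` and of the per-label integers `Z, P, DD` of `…HomLeafTableCheckHcpV`, their exact real
meanings (reals = integers / `SC`), the flooring facts `SC³·Q ≤ ‖P‖² < SC³·(Q + 1)`, `RR < SC³·(R − 1)`, and ★ `label_value_facts`: for every `V`, `η`
in the leaf box and every consistent record, `|q − q̂| ≤ (R − 1)/SC` and `Q/SC ≤ q̂ ≤ (Q + 1)/SC`, where `q = ‖V(e + uη)‖²` and `q̂ = ‖V̂ z⁰‖²`
(via `…HomLeafVectorForm.abs_normSq_sub_le`); ★ `far_of_farBV_real`: an untreated passing record is beyond the cutoff.  Small proof-side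
definitions only.  0 sorry; standard axioms.  `--supports stmt-AtomisticToContinuum-27623`.
-/

noncomputable section

namespace Summit.AtomisticToContinuum.Crystallization.Theorems.FrustratedLawDichotomyStrainedPatchHomLeafTableCheckHcpV

open scoped BigOperators
open Finset
open Literature.Analysis.ValidatedNumerics.Numerics
open Summit.AtomisticToContinuum.Crystallization.Theorems.FrustratedLawDichotomyStrainedPatchHomLeafVectorForm (abs_normSq_sub_le far_of_ref)
open Summit.AtomisticToContinuum.Crystallization.Theorems.FrustratedLawDichotomyStrainedPatchHomLeafTableCheck (Row QT sgnZ SCN SCN_eq)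
open Summit.AtomisticToContinuum.Crystallization.Theorems.FrustratedLawDichotomyStrainedPatchHomLeafTableCheckHcp (NH famZ NH.ok_iff)

/-! ## §1. Readings -/

/-- The centre matrix `SC·V̂` as a function. -/
def LV.vZ (k : LV) : Fin 3 → Fin 3 → ℤ := ![![k.v00, k.v01, k.v02], ![k.v10, k.v11, k.v12], ![k.v20, k.v21, k.v22]]

/-- The half-widths `SC·Ŵ` as a function. -/
def LV.wN (k : LV) : Fin 3 → Fin 3 → ℕ := ![![k.w00, k.w01, k.w02], ![k.w10, k.w11, k.w12], ![k.w20, k.w21, k.w22]]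

/-- The scaled shuffle centre `SC·η̂`. -/
def LV.nZ (k : LV) : Fin 3 → ℤ := ![k.n0, k.n1, k.n2]

/-- The scaled shuffle half-widths `SC·Ŵη`. -/
def LV.mN (k : LV) : Fin 3 → ℕ := ![k.m0, k.m1, k.m2]

/-- The integer frame vector `e = (2b₀ + b₁ + u, 3b₁ + u, 2b₂ + u)` of a record. -/
def eZ (l : NH) : Fin 3 → ℤ := ![e0 l, e1 l, e2 l]

/-- `Z = SC·e + u·η̂` as a function. -/
def ZZ (k : LV) (l : NH) : Fin 3 → ℤ := ![Z0 k l, Z1 k l, Z2 k l]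

/-- `P = V̂ Z` as a function. -/
def PZ (k : LV) (l : NH) : Fin 3 → ℤ := ![P0 k l, P1 k l, P2 k l]

/-- The deviation bounds `DD` as a function. -/
def DDN (k : LV) (l : NH) : Fin 3 → ℕ := ![DD0 k l, DD1 k l, DD2 k l]

/-- The real centre vector `z⁰ = e + u·η̂` of a record on a leaf. -/
def zre (k : LV) (l : NH) (c : Fin 3) : ℝ := ((eZ l c : ℤ) : ℝ) + (l.u : ℝ) * (((k.nZ c : ℤ) : ℝ) / SC)

/-- The real value `q = ‖V (e + u η)‖²` of a record at `(V, η)`. -/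
def qre (l : NH) (V : Fin 3 → Fin 3 → ℝ) (η : Fin 3 → ℝ) : ℝ := ∑ a, (∑ c, V a c * (((eZ l c : ℤ) : ℝ) + (l.u : ℝ) * η c)) ^ 2

/-- The real centre value `q̂ = ‖V̂ z⁰‖²`. -/
def qhat (k : LV) (l : NH) : ℝ := ∑ a, (∑ c, ((k.vZ a c : ℤ) : ℝ) / SC * zre k l c) ^ 2

/-! ## §2. Exact real meanings of the per-label integers -/

/-- `SC3N = SC³`. [formal bookkeeping] -/
theorem SC3N_real : ((SC3N : ℕ) : ℝ) = (SC : ℝ) ^ 3 := by norm_num [SC3N, SC]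

/-- A consistent record has `u ∈ {0, 1}`. [formal bookkeeping] -/
theorem u01_of_ok {l : NH} (hl : l.ok = true) : (l.u : ℝ) = 0 ∨ (l.u : ℝ) = 1 := by
  obtain ⟨-, -, -, -, -, -, -, -, -, hu⟩ := (NH.ok_iff l).1 hl
  cases hf : l.fam
  · left; rw [hf] at hu; simp only [famZ] at hu; exact_mod_cast hu
  · right; rw [hf] at hu; simp only [famZ] at hu; exact_mod_cast hu

/-- `Z_c / SC = z⁰_c`. [formal bookkeeping] -/
theorem ZZ_real (k : LV) (l : NH) (c : Fin 3) : ((ZZ k l c : ℤ) : ℝ) = SC * zre k l c := by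
  have hS := SC_pos
  fin_cases c <;>
  · simp only [ZZ, Z0, Z1, Z2, zre, eZ, LV.nZ, Int.add_def, Int.mul_def, SCN_eq, Fin.zero_eta, Fin.isValue, Fin.mk_one, Fin.reduceFinMk,
      Matrix.cons_val_zero, Matrix.cons_val_one, Matrix.cons_val]
    push_cast; field_simp

/-- `P_a = Σ_c v_ac Z_c`. [formal bookkeeping] -/
theorem PZ_real (k : LV) (l : NH) (a : Fin 3) : ((PZ k l a : ℤ) : ℝ) = ∑ c, ((k.vZ a c : ℤ) : ℝ) * ((ZZ k l c : ℤ) : ℝ) := by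
  fin_cases a <;>
  · simp only [PZ, P0, P1, P2, ZZ, LV.vZ, Int.add_def, Int.mul_def, Fin.sum_univ_three, Fin.zero_eta, Fin.isValue, Fin.mk_one, Fin.reduceFinMk,
      Matrix.cons_val_zero, Matrix.cons_val_one, Matrix.cons_val]
    push_cast; ring

/-- `P_a / SC² = (V̂ z⁰)_a`. [formal bookkeeping] -/
theorem PZ_real' (k : LV) (l : NH) (a : Fin 3) : ((PZ k l a : ℤ) : ℝ) / SC ^ 2 = ∑ c, ((k.vZ a c : ℤ) : ℝ) / SC * zre k l c := by
  have hS := SC_pos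
  rw [PZ_real, Finset.sum_div]
  refine Finset.sum_congr rfl fun c _ => ?_
  rw [ZZ_real]; field_simp

/-- `QQ = Σ_a P_a²`. [formal bookkeeping] -/
theorem QQ_real (k : LV) (l : NH) : ((QQ k l : ℕ) : ℝ) = ∑ a, ((PZ k l a : ℤ) : ℝ) ^ 2 := by
  have h : ∀ x : ℤ, ((x.natAbs * x.natAbs : ℕ) : ℝ) = ((x : ℤ) : ℝ) ^ 2 := by
    intro x; push_cast; rw [Nat.cast_natAbs, Int.cast_abs, ← abs_mul, abs_mul_self]; ring
  simp only [QQ, Nat.add_eq, Nat.mul_eq, PZ, Fin.sum_univ_three, Fin.isValue, Matrix.cons_val_zero, Matrix.cons_val_one, Matrix.cons_val]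
  push_cast
  rw [← h, ← h, ← h]; push_cast; ring

/-- `QQ / SC⁴ = q̂`. [formal bookkeeping] -/
theorem qhat_eq (k : LV) (l : NH) : qhat k l = ((QQ k l : ℕ) : ℝ) / SC ^ 4 := by
  have hS := SC_pos
  rw [QQ_real, Finset.sum_div]
  unfold qhat
  refine Finset.sum_congr rfl fun a _ => ?_
  rw [← PZ_real']; field_simp

/-- `DD_a` in reals: `Σ_c w_ac |Z_c| + u (Σ_c |v_ac| m_c + Σ_c w_ac m_c)`. [formal bookkeeping] -/
theorem DDN_real (k : LV) (l : NH) (a : Fin 3) : ((DDN k l a : ℕ) : ℝ) =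
    ∑ c, ((k.wN a c : ℕ) : ℝ) * |((ZZ k l c : ℤ) : ℝ)| + (l.u : ℝ) * (∑ c, |((k.vZ a c : ℤ) : ℝ)| * ((k.mN c : ℕ) : ℝ) + ∑ c, ((k.wN a c : ℕ) : ℝ) * ((k.mN c : ℕ) : ℝ)) := by
  have h : ∀ x : ℤ, ((x.natAbs : ℕ) : ℝ) = |((x : ℤ) : ℝ)| := fun x => by rw [Nat.cast_natAbs, Int.cast_abs]
  fin_cases a <;>
  · simp only [DDN, DD0, DD1, DD2, shufD, ZZ, LV.vZ, LV.wN, LV.mN, Nat.add_eq, Nat.mul_eq, Fin.sum_univ_three, Fin.zero_eta, Fin.isValue, Fin.mk_one,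
      Fin.reduceFinMk, Matrix.cons_val_zero, Matrix.cons_val_one, Matrix.cons_val]
    push_cast
    simp only [h]

/-- `DD_a / SC²` as the deviation bound `D_a` of `abs_dev_le` with `Ŵ = w/SC`, `Ŵη = m/SC`, `V̂ = v/SC`, `z⁰`. [formal bookkeeping] -/
theorem DDN_real' (k : LV) (l : NH) (a : Fin 3) : ((DDN k l a : ℕ) : ℝ) / SC ^ 2 =
    ∑ c, ((k.wN a c : ℕ) : ℝ) / SC * |zre k l c| +
      (l.u : ℝ) * (∑ c, |((k.vZ a c : ℤ) : ℝ) / SC| * (((k.mN c : ℕ) : ℝ) / SC) + ∑ c, ((k.wN a c : ℕ) : ℝ) / SC * (((k.mN c : ℕ) : ℝ) / SC)) := by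
  have hS := SC_pos
  rw [DDN_real]
  have hz : ∀ c, |((ZZ k l c : ℤ) : ℝ)| = SC * |zre k l c| := fun c => by rw [ZZ_real, abs_mul, abs_of_pos hS]
  have hv : ∀ c, |((k.vZ a c : ℤ) : ℝ) / SC| = |((k.vZ a c : ℤ) : ℝ)| / SC := fun c => by rw [abs_div, abs_of_pos hS]
  simp only [hz, hv]
  simp only [Fin.sum_univ_three]
  field_simp

/-- `RR = 2 Σ_a |P_a| DD_a + Σ_a DD_a²`. [formal bookkeeping] -/
theorem RR_real (k : LV) (l : NH) : ((RR k l : ℕ) : ℝ) = 2 * ∑ a, |((PZ k l a : ℤ) : ℝ)| * ((DDN k l a : ℕ) : ℝ) + ∑ a, ((DDN k l a : ℕ) : ℝ) ^ 2 := by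
  have h : ∀ x : ℤ, ((x.natAbs : ℕ) : ℝ) = |((x : ℤ) : ℝ)| := fun x => by rw [Nat.cast_natAbs, Int.cast_abs]
  simp only [RR, Nat.add_eq, Nat.mul_eq, PZ, DDN, Fin.sum_univ_three, Fin.isValue, Matrix.cons_val_zero, Matrix.cons_val_one, Matrix.cons_val]
  push_cast
  simp only [h]
  ring

/-! ## §3. The floorings -/

/-- `SC³·Q ≤ QQ < SC³·(Q + 1)`. [formal bookkeeping] -/
theorem QV_bounds (k : LV) (l : NH) : ((QV k l : ℕ) : ℝ) * SC ^ 3 ≤ ((QQ k l : ℕ) : ℝ) ∧ ((QQ k l : ℕ) : ℝ) < (((QV k l : ℕ) : ℝ) + 1) * SC ^ 3 := by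
  have hQ : QV k l = QQ k l / SC3N := rfl
  have h1 : QV k l * SC3N ≤ QQ k l := by rw [hQ]; exact Nat.div_mul_le_self _ _
  have h2 : QQ k l < (QV k l + 1) * SC3N := by
    rw [hQ, Nat.add_mul, Nat.one_mul]; exact Nat.lt_div_mul_add (show 0 < SC3N by norm_num [SC3N])
  rw [← SC3N_real]
  exact ⟨by exact_mod_cast h1, by exact_mod_cast h2⟩

/-- `RR < SC³·(R − 1)`. [formal bookkeeping] -/
theorem RV_bound (k : LV) (l : NH) : ((RR k l : ℕ) : ℝ) < (((RV k l : ℕ) : ℝ) - 1) * SC ^ 3 := by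
  have h2 : RR k l < (RR k l / SC3N + 1) * SC3N := by
    rw [Nat.add_mul, Nat.one_mul]; exact Nat.lt_div_mul_add (show 0 < SC3N by norm_num [SC3N])
  have hR : RV k l = RR k l / SC3N + 2 := rfl
  have h3 : ((RV k l : ℕ) : ℝ) - 1 = ((RR k l / SC3N + 1 : ℕ) : ℝ) := by rw [hR]; push_cast; ring
  rw [h3, ← SC3N_real]
  exact_mod_cast h2

/-! ## §4. ★ The per-label value facts on the box -/

/-- `q` in the form of `abs_normSq_sub_le`: `V(e + uη) = V(z⁰ + u(η − η̂))`. [formal bookkeeping] -/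
theorem qre_eq (k : LV) (l : NH) (V : Fin 3 → Fin 3 → ℝ) (η : Fin 3 → ℝ) :
    qre l V η = ∑ a, (∑ c, V a c * (zre k l c + (l.u : ℝ) * (η c - ((k.nZ c : ℤ) : ℝ) / SC))) ^ 2 := by
  unfold qre zre
  refine Finset.sum_congr rfl fun a _ => ?_
  congr 1
  exact Finset.sum_congr rfl fun c _ => by ring

/-- ★ **PER-LABEL VALUE FACTS.**  For `V`, `η` in the leaf box and a consistent record: `|q − q̂| ≤ (R − 1)/SC`, `Q/SC ≤ q̂ ≤ (Q + 1)/SC`.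
[folklore: interval bookkeeping] -/
theorem label_value_facts {k : LV} {l : NH} (hl : l.ok = true) {V : Fin 3 → Fin 3 → ℝ} {η : Fin 3 → ℝ}
    (hV : ∀ a c, |V a c - ((k.vZ a c : ℤ) : ℝ) / SC| ≤ ((k.wN a c : ℕ) : ℝ) / SC)
    (hη : ∀ c, |η c - ((k.nZ c : ℤ) : ℝ) / SC| ≤ ((k.mN c : ℕ) : ℝ) / SC) :
    |qre l V η - qhat k l| ≤ (((RV k l : ℕ) : ℝ) - 1) / SC ∧ ((QV k l : ℕ) : ℝ) / SC ≤ qhat k l ∧ qhat k l ≤ (((QV k l : ℕ) : ℝ) + 1) / SC := by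
  have hS := SC_pos
  have hS4 : (0 : ℝ) < SC ^ 4 := by positivity
  refine ⟨?_, ?_, ?_⟩
  · have h := abs_normSq_sub_le V (fun a c => ((k.vZ a c : ℤ) : ℝ) / SC) (fun a c => ((k.wN a c : ℕ) : ℝ) / SC) η
      (fun c => ((k.nZ c : ℤ) : ℝ) / SC) (fun c => ((k.mN c : ℕ) : ℝ) / SC) (zre k l) (l.u : ℝ) (u01_of_ok hl) hV hη
    rw [← qre_eq] at h
    have hb : 2 * ∑ a, |∑ c, ((k.vZ a c : ℤ) : ℝ) / SC * zre k l c| *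
          (∑ c, ((k.wN a c : ℕ) : ℝ) / SC * |zre k l c| + (l.u : ℝ) * (∑ c, |((k.vZ a c : ℤ) : ℝ) / SC| * (((k.mN c : ℕ) : ℝ) / SC) +
            ∑ c, ((k.wN a c : ℕ) : ℝ) / SC * (((k.mN c : ℕ) : ℝ) / SC))) +
        ∑ a, (∑ c, ((k.wN a c : ℕ) : ℝ) / SC * |zre k l c| + (l.u : ℝ) * (∑ c, |((k.vZ a c : ℤ) : ℝ) / SC| * (((k.mN c : ℕ) : ℝ) / SC) +
            ∑ c, ((k.wN a c : ℕ) : ℝ) / SC * (((k.mN c : ℕ) : ℝ) / SC))) ^ 2 = ((RR k l : ℕ) : ℝ) / SC ^ 4 := by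
      rw [RR_real]
      simp only [← DDN_real', ← PZ_real']
      have e1 : ∀ a, |((PZ k l a : ℤ) : ℝ) / SC ^ 2| = |((PZ k l a : ℤ) : ℝ)| / SC ^ 2 := fun a => by rw [abs_div, abs_of_pos (pow_pos hS 2)]
      simp only [e1, Fin.sum_univ_three]
      field_simp
    have hq : qhat k l = ∑ a, (∑ c, ((k.vZ a c : ℤ) : ℝ) / SC * zre k l c) ^ 2 := rfl
    rw [← hq] at h
    rw [hb] at h
    refine h.trans ?_
    have := RV_bound k l
    rw [div_le_div_iff₀ hS4 hS]
    nlinarith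
  · rw [qhat_eq, div_le_div_iff₀ hS hS4]
    nlinarith [(QV_bounds k l).1]
  · rw [qhat_eq, div_le_div_iff₀ hS4 hS]
    nlinarith [(QV_bounds k l).2]

/-- ★ The FAR case: a passing untreated consistent record has `81/4 ≤ q` on the box. [formal bookkeeping] -/
theorem far_of_farBV_real {tab : QT} {k : LV} {l : NH} (hl : l.ok = true) (hs : stepOKV tab k l = true) (ht : treatedV tab k l = false)
    {V : Fin 3 → Fin 3 → ℝ} {η : Fin 3 → ℝ} (hV : ∀ a c, |V a c - ((k.vZ a c : ℤ) : ℝ) / SC| ≤ ((k.wN a c : ℕ) : ℝ) / SC)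
    (hη : ∀ c, |η c - ((k.nZ c : ℤ) : ℝ) / SC| ≤ ((k.mN c : ℕ) : ℝ) / SC) : (81 : ℝ) / 4 ≤ qre l V η := by
  have hS := SC_pos
  obtain ⟨h1, h2⟩ := farBV_of_untreated hs ht
  obtain ⟨hq, hQ, -⟩ := label_value_facts (k := k) hl hV hη
  refine far_of_ref hq hQ ?_
  rw [SCN_eq] at h2
  have h3 : (81 : ℝ) * SC ≤ 4 * (((QV k l : ℕ) : ℝ) - ((RV k l : ℕ) : ℝ)) := by
    have : ((81 * SC : ℕ) : ℝ) ≤ ((4 * (QV k l - RV k l) : ℕ) : ℝ) := by exact_mod_cast h2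
    push_cast [Nat.cast_sub h1] at this
    exact this
  rw [← sub_div, le_div_iff₀ hS]
  linarith

end Summit.AtomisticToContinuum.Crystallization.Theorems.FrustratedLawDichotomyStrainedPatchHomLeafTableCheckHcpV

end
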